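import Summits.QuantumFields.YangMills.Theorems.TwistedTraceScaling.Negative.CoreWindowSufficiency
import Summits.QuantumFields.YangMills.Theorems.TwistedTraceScaling.Negative.CoreWindowBand
import HarnessLib

/-!
# R57 — the record SHADOW WINDOW `δ₁ = 14β^{-s}/|Site|` and the (C4) CURRENCY CONSTANT `b_core` of lane A's `core_defect_currency`, priced against the box

Lane A (`ym-luscher-20007-p1` g19, END OF GEN 2026-08-29T12:20Z; pub `g19-BODefectCoreCurrency.lean`, `g19-BODefectCoreRecord.lean`) converts the (C4) core
estimate into the `hOD` currency: for test functions `φ` supported in the slow window `orbitDist u < 14·powScale s β/|Site 3 L|` (the window delivered by the landed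
`…RecordShadow`: `RecordBOInput.hshadow` with `δ₁ β = 14·powScale s β/|Site|`, `K = 43`),
`∫_{S_in} E_core² w ≤ (b_core·σ_BT·λ₀)²·‖φ⊗Ω_c‖²_w` with
`b_core = (max (1 − e^{−E}(1 − η_c)) (e^{E}(1 + η_c) − 1) + κ_P)·√(8/((1 − κ_P)(1 − η_c)²(1 − κ_Q)))`, `η_c = powScale (1/5) β` (the central ratio/quasimode RATE),
`E = coreEta + coreEps1 + coreEps2` (the core-defect exponent of `core_transfer_defect_le` at the windows `δ = Dβ^{-s}`, `δu = 14β^{-s}`, `σ = β^{-2s}`), `κ_P = C_P(43β^{-s})²`,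
`κ_Q = C_Q(43β^{-s})²`.  This file prices the two new constants against the (C4) box of R54/R54B/R55/R55B (`1/6 < s`, input exponent `p ≤ 1/5`, `hb_small ⟺ floors > 1/6`):

* §1 THE SHADOW WINDOW AT THE ENDPOINT `s = 1/5`.  `RecordBOInput` asks `hcore : 13(L³β)^{-1/5} < δ₁ β` and `hradii : |E|·(4r + δ₁) < K·powScale s β` eventually.  At `s = 1/5`
  these two are JOINTLY UNSATISFIABLE unless `K > 39·(L³)^{4/5}` (★ `record_hradii_false_of_hcore_fifth`): with the record's `K = 43` that means `L = 1`
  (★★ `record_no_shadowWindow_fifth`, `L ≥ 2`); in particular lane A's `δ₁ = 14β^{-1/5}/|Site|` misses the core (`shadowWindow_not_hcore_fifth`).  For `s < 1/5` the same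
  `δ₁` contains the core eventually (`shadowWindow_hcore_of_lt_fifth`, any `L`).  So with the record weight `recordChi L s 43 M` the window is the OPEN interval `1/6 < s < 1/5`
  (R55B allowed `p = 1/5` with amplitude `A ≥ 13`; the shadow/radii bookkeeping pins the amplitude at `14/L³ < 13`).
* §2 THE CURRENCY CONSTANT INHERITS EVERY FLOOR.  For `E ≥ 0`, `0 ≤ η_c < 1`, `0 ≤ κ_P < 1`, `0 ≤ κ_Q < 1`: `b_core ≥ √8·η_c` (★ `currency_ge_rate`), `b_core ≥ √8·κ_P`
  (`currency_ge_kappaP`), `b_core ≥ √8·E` (★ `currency_ge_exponent`).  Consequences: the hOD constant is RATE-LIMITED — a central rate `powScale r β` with `r ≤ 1/6` sinks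
  `hb_small` for `b_core` (★★ `currency_not_hb_small_of_rate_le_sixth`; lane A's `r = 1/5` passes: `currency_rate_fifth_affordable`, margin `β^{-1/15}`), and the whole (C4)
  window ledger of R54 transfers VERBATIM to `b_core` (★★ `currency_not_hb_small_of_input_radius`: the input-radius slot `δu = 14·powScale s β` with `s ≤ 1/6` sinks it, every `D ≥ 0`).

HONEST FRAMING: side conditions / tightness of constants of a CONDITIONAL reduction route (R2b1, crux `TwistedTraceScaling`, stmt-QuantumFields-20203); nothing landed is
refuted (lane A states `1/6 < s < 1/4` and `r = 1/5`); (C5), the hOD assembly, (B-ST), C4-CORE remain OPEN; not infinite volume, not a mass gap, not Clay.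
-/

set_option autoImplicit false

noncomputable section

open Real Filter Topology
open Literature.MathematicalPhysics.QuantumFieldTheory
open Literature.MathematicalPhysics.QuantumLattice
open Summit.QuantumFields.YangMills.Theorems.FemtoTransferGap
open Summit.QuantumFields.YangMills.Theorems.FemtoTransferGap.TwoLattice
open Summit.QuantumFields.YangMills.Theorems.FemtoTransferGap.TwoLattice.ConstTube (coreEta coreEps1 coreEps2 btLog one_le_btLog coreEps1_nonneg coreEps2_nonneg
  coreEta_nonneg powScale_mul_powScale tendsto_powScale')
open Summit.QuantumFields.YangMills.Theorems.TwistedTraceScaling.Negative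

namespace Summit.QuantumFields.YangMills.Theorems.TwistedTraceScaling.Negative.R57

variable {L : ℕ} [NeZero L]

/-! ## §1 The shadow window `δ₁ = 14·powScale s β/|Site|` against `hcore` and `hradii` -/

omit [NeZero L] in
/-- The constant behind §1: for `L ≥ 2`, `43 < 39·L³·(L³)^{-1/5}` (`= 39(L³)^{4/5} ≥ 39√8`). [folklore] -/
theorem fortythree_lt_coreConst (hL : 2 ≤ L) : (43 : ℝ) < 39 * (L : ℝ) ^ 3 * ((L : ℝ) ^ 3) ^ (-(1 / 5 : ℝ)) := by
  have hL' : (2 : ℝ) ≤ (L : ℝ) := by exact_mod_cast hL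
  set x : ℝ := (L : ℝ) ^ 3 with hx
  have hx8 : 8 ≤ x := by
    rw [hx, show (8 : ℝ) = 2 ^ 3 by norm_num]
    exact pow_le_pow_left₀ (by norm_num) hL' 3
  have hx0 : 0 < x := by linarith
  have hx1 : 1 ≤ x := by linarith
  -- `x^{-1/2} ≤ x^{-1/5}` and `x · x^{-1/2} = √x ≥ √8 ≥ 2`
  have h1 : x ^ (-(1 / 2 : ℝ)) ≤ x ^ (-(1 / 5 : ℝ)) := Real.rpow_le_rpow_of_exponent_le hx1 (by norm_num)
  have h2 : x * x ^ (-(1 / 2 : ℝ)) = Real.sqrt x := by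
    have h := Real.rpow_add hx0 1 (-(1 / 2 : ℝ))
    rw [Real.rpow_one] at h
    rw [← h, Real.sqrt_eq_rpow]
    norm_num
  have h3 : (2 : ℝ) ≤ Real.sqrt x := by
    rw [show (2 : ℝ) = Real.sqrt (2 ^ 2) from (Real.sqrt_sq (by norm_num)).symm]
    exact Real.sqrt_le_sqrt (by linarith)
  have h4 : 2 ≤ x * x ^ (-(1 / 5 : ℝ)) := by
    calc (2 : ℝ) ≤ Real.sqrt x := h3
      _ = x * x ^ (-(1 / 2 : ℝ)) := h2.symm
      _ ≤ x * x ^ (-(1 / 5 : ℝ)) := mul_le_mul_of_nonneg_left h1 hx0.le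
  nlinarith

/-- ★ **`hcore` AND `hradii` OF `RecordBOInput` ARE JOINTLY UNSATISFIABLE AT `s = 1/5` UNLESS `K > 39(L³)^{4/5}`**: if the shadow window `δ₁` contains the core
(`13(L³β)^{-1/5} < δ₁ β` eventually) then `|E|·(4r + δ₁) < K·powScale (1/5) β` eventually forces `39·L³·(L³)^{-1/5} < K` (`|E| = 3L³`, `r ≥ 0`). [folklore] -/
theorem record_K_gt_of_hcore_fifth {δ₁ r : ℝ → ℝ} {K : ℝ} (hr : ∀ β, 0 ≤ r β)
    (hcore : ∀ᶠ β : ℝ in atTop, 13 * (((L : ℝ)) ^ 3 * β) ^ (-(1 / 5 : ℝ)) < δ₁ β)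
    (hradii : ∀ᶠ β : ℝ in atTop, (Fintype.card (Edge 3 L) : ℝ) * (4 * r β + δ₁ β) < K * powScale (1 / 5) β) :
    39 * (L : ℝ) ^ 3 * ((L : ℝ) ^ 3) ^ (-(1 / 5 : ℝ)) < K := by
  obtain ⟨β, hc, hrad, hβ1⟩ := (hcore.and (hradii.and (eventually_ge_atTop (1 : ℝ)))).exists
  have hE : (Fintype.card (Edge 3 L) : ℝ) = 3 * (L : ℝ) ^ 3 := by
    rw [Fintype.card_prod, Fintype.card_pi, Finset.prod_const, Finset.card_univ, Fintype.card_fin, ZMod.card]; push_cast; ring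
  have hL0 : (0 : ℝ) ≤ (L : ℝ) ^ 3 := by positivity
  rw [R54.coreRadius_eq hβ1] at hc
  rw [hE] at hrad
  have hp : 0 < powScale (1 / 5) β := powScale_pos _ _
  have hδ : 3 * (L : ℝ) ^ 3 * δ₁ β < K * powScale (1 / 5) β := by nlinarith [hr β]
  have h1 : 3 * (L : ℝ) ^ 3 * (13 * ((L : ℝ) ^ 3) ^ (-(1 / 5 : ℝ)) * powScale (1 / 5) β) ≤ 3 * (L : ℝ) ^ 3 * δ₁ β :=
    mul_le_mul_of_nonneg_left hc.le (by positivity)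
  have h2 : (39 * (L : ℝ) ^ 3 * ((L : ℝ) ^ 3) ^ (-(1 / 5 : ℝ))) * powScale (1 / 5) β < K * powScale (1 / 5) β := by nlinarith
  exact lt_of_mul_lt_mul_right h2 hp.le

/-- ★★ **WITH THE RECORD'S `K = 43` AND `L ≥ 2` THERE IS NO SHADOW WINDOW AT `s = 1/5`**: no `δ₁` satisfies both `hcore` and `hradii` of `RecordBOInput L (1/5) 43 M`
(`39(L³)^{4/5} ≥ 39√8 > 43`). So for the record weight `recordChi L s 43 M` the (C4)/(C5) window is the OPEN interval `1/6 < s < 1/5`. [folklore] -/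
theorem record_no_shadowWindow_fifth (hL : 2 ≤ L) {δ₁ r : ℝ → ℝ} (hr : ∀ β, 0 ≤ r β)
    (hcore : ∀ᶠ β : ℝ in atTop, 13 * (((L : ℝ)) ^ 3 * β) ^ (-(1 / 5 : ℝ)) < δ₁ β) :
    ¬ ∀ᶠ β : ℝ in atTop, (Fintype.card (Edge 3 L) : ℝ) * (4 * r β + δ₁ β) < 43 * powScale (1 / 5) β := fun hradii =>
  absurd (record_K_gt_of_hcore_fifth (L := L) hr hcore hradii) (not_lt.mpr (fortythree_lt_coreConst hL).le)

/-- In particular lane A's `δ₁ = 14·powScale (1/5) β/|Site 3 L|` (the `…RecordShadow` window, used as the `φ`-support window of `core_defect_currency`) misses the core at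
`s = 1/5` for every `L ≥ 2` (`14/L³ < 13(L³)^{-1/5}`). [folklore] -/
theorem shadowWindow_not_hcore_fifth (hL : 2 ≤ L) :
    ¬ ∀ᶠ β : ℝ in atTop, 13 * (((L : ℝ)) ^ 3 * β) ^ (-(1 / 5 : ℝ)) < 14 * powScale (1 / 5) β / Fintype.card (Site 3 L) := by
  intro H
  have hS : (Fintype.card (Site 3 L) : ℝ) = (L : ℝ) ^ 3 := by
    rw [Fintype.card_pi, Finset.prod_const, Finset.card_univ, Fintype.card_fin, ZMod.card]; push_cast; ring
  have hL' : (2 : ℝ) ≤ (L : ℝ) := by exact_mod_cast hL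
  have hL0 : (0 : ℝ) < (L : ℝ) ^ 3 := by positivity
  refine record_no_shadowWindow_fifth (L := L) hL (r := fun _ => 0) (fun _ => le_rfl) H ?_
  filter_upwards [eventually_ge_atTop (1 : ℝ)] with β hβ1
  have hE : (Fintype.card (Edge 3 L) : ℝ) = 3 * (L : ℝ) ^ 3 := by
    rw [Fintype.card_prod, Fintype.card_pi, Finset.prod_const, Finset.card_univ, Fintype.card_fin, ZMod.card]; push_cast; ring
  rw [hE, hS]
  have hp : 0 < powScale (1 / 5) β := powScale_pos _ _
  have : 3 * (L : ℝ) ^ 3 * (4 * 0 + 14 * powScale (1 / 5) β / (L : ℝ) ^ 3) = 42 * powScale (1 / 5) β := by field_simp; ring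
  rw [this]; nlinarith

/-- For `s < 1/5` the same window DOES contain the core eventually (any `L ≥ 1`): `13(L³β)^{-1/5} < 14·powScale s β/|Site|`. [folklore] -/
theorem shadowWindow_hcore_of_lt_fifth {s : ℝ} (hs : s < 1 / 5) :
    ∀ᶠ β : ℝ in atTop, 13 * (((L : ℝ)) ^ 3 * β) ^ (-(1 / 5 : ℝ)) < 14 * powScale s β / Fintype.card (Site 3 L) := by
  have hS : (Fintype.card (Site 3 L) : ℝ) = (L : ℝ) ^ 3 := by
    rw [Fintype.card_pi, Finset.prod_const, Finset.card_univ, Fintype.card_fin, ZMod.card]; push_cast; ring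
  have hL0 : (0 : ℝ) < (L : ℝ) ^ 3 := pow_pos (by exact_mod_cast Nat.pos_of_ne_zero (NeZero.ne L)) 3
  have hA : (0 : ℝ) < 7 / (L : ℝ) ^ 3 := by positivity
  filter_upwards [R55B.coreRadius_le_of_exponent_lt (L := L) hs hA] with β h
  have hp : 0 < powScale s β := powScale_pos _ _
  rw [hS]
  calc 13 * (((L : ℝ)) ^ 3 * β) ^ (-(1 / 5 : ℝ)) ≤ 7 / (L : ℝ) ^ 3 * powScale s β := h
    _ < 14 * powScale s β / (L : ℝ) ^ 3 := by
        rw [div_mul_eq_mul_div, lt_div_iff₀ hL0, div_mul_cancel₀ _ hL0.ne']; nlinarith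

omit [NeZero L] in
/-- The `/|Site|` is what costs the endpoint — not the window clause it was introduced for: without it, `δ₁ = 14·powScale s β` still puts the support of `φ` inside the
(C4) action window, `L³·12·(14β^{-s})⁴ ≤ β^{-2s}` eventually for every `s > 0` (lane A's `hwin` step); it is `hradii` (`|E|·δ₁ < 43β^{-s}`, `|E| = 3L³`) that pins the
amplitude at `14/L³`. [folklore] -/
theorem actionWindow_of_radius_without_div {s : ℝ} (hs : 0 < s) :
    ∀ᶠ β : ℝ in atTop, (L : ℝ) ^ 3 * (12 * (14 * powScale s β) ^ 4) ≤ powScale (2 * s) β := by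
  have ht : Tendsto (fun β : ℝ => (L : ℝ) ^ 3 * 12 * 14 ^ 4 * powScale (2 * s) β) atTop (𝓝 0) := by
    have h := (tendsto_powScale' (by linarith : 0 < 2 * s)).const_mul ((L : ℝ) ^ 3 * 12 * 14 ^ 4)
    rw [mul_zero] at h; exact h
  filter_upwards [ht.eventually (eventually_le_nhds one_pos)] with β h1
  have hp : 0 < powScale (2 * s) β := powScale_pos _ _
  have e : powScale s β ^ 4 = powScale (2 * s) β * powScale (2 * s) β := by
    rw [show (4 : ℕ) = 2 * 2 by norm_num, pow_mul, R21.powScale_sq]; ring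
  calc (L : ℝ) ^ 3 * (12 * (14 * powScale s β) ^ 4) = ((L : ℝ) ^ 3 * 12 * 14 ^ 4 * powScale (2 * s) β) * powScale (2 * s) β := by rw [mul_pow, e]; ring
    _ ≤ 1 * powScale (2 * s) β := mul_le_mul_of_nonneg_right h1 hp.le
    _ = powScale (2 * s) β := one_mul _

/-! ## §2 The currency constant `b_core` inherits every floor: rate, `κ_P`, exponent -/

/-- The square-root factor of `b_core` is at least `√8`: `(1 − κ_P)(1 − η_c)²(1 − κ_Q) ∈ (0, 1]`. [folklore] -/
theorem sqrt_factor_ge {ηc κP κQ : ℝ} (hηc : 0 ≤ ηc) (hηc1 : ηc < 1) (hκP : 0 ≤ κP) (hκP1 : κP < 1) (hκQ : 0 ≤ κQ) (hκQ1 : κQ < 1) :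
    Real.sqrt 8 ≤ Real.sqrt (8 / ((1 - κP) * (1 - ηc) ^ 2 * (1 - κQ))) := by
  have hD0 : 0 < (1 - κP) * (1 - ηc) ^ 2 * (1 - κQ) := by
    have : 0 < (1 - ηc) ^ 2 := by nlinarith
    positivity
  have hD1 : (1 - κP) * (1 - ηc) ^ 2 * (1 - κQ) ≤ 1 := by
    have h1 : (1 - κP) * (1 - ηc) ^ 2 ≤ 1 := by
      calc (1 - κP) * (1 - ηc) ^ 2 ≤ 1 * 1 := mul_le_mul (by linarith) (by nlinarith) (by positivity) (by norm_num)
        _ = 1 := by norm_num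
    calc (1 - κP) * (1 - ηc) ^ 2 * (1 - κQ) ≤ 1 * 1 := mul_le_mul h1 (by linarith) (by linarith) (by norm_num)
      _ = 1 := by norm_num
  exact Real.sqrt_le_sqrt ((le_div_iff₀ hD0).mpr (by nlinarith))

/-- The first factor of `b_core` is at least the rate: `max (1 − e^{−E}(1 − η_c)) (e^{E}(1 + η_c) − 1) + κ_P ≥ η_c` (`E ≥ 0`, `κ_P ≥ 0`). [folklore] -/
theorem first_factor_ge_rate {E ηc κP : ℝ} (hE : 0 ≤ E) (hηc : 0 ≤ ηc) (hκP : 0 ≤ κP) :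
    ηc ≤ max (1 - Real.exp (-E) * (1 - ηc)) (Real.exp E * (1 + ηc) - 1) + κP := by
  have hexp : 1 ≤ Real.exp E := Real.one_le_exp hE
  have h2 : ηc ≤ Real.exp E * (1 + ηc) - 1 := by nlinarith
  exact le_add_of_le_of_nonneg (h2.trans (le_max_right _ _)) hκP

/-- … at least `κ_P`. [folklore] -/
theorem first_factor_ge_kappaP {E ηc κP : ℝ} (hE : 0 ≤ E) (hηc : 0 ≤ ηc) :
    κP ≤ max (1 - Real.exp (-E) * (1 - ηc)) (Real.exp E * (1 + ηc) - 1) + κP := by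
  have hexp : 1 ≤ Real.exp E := Real.one_le_exp hE
  have h2 : 0 ≤ Real.exp E * (1 + ηc) - 1 := by nlinarith
  exact le_add_of_nonneg_left (h2.trans (le_max_right _ _))

/-- … and at least the exponent: `e^{E}(1 + η_c) − 1 ≥ e^{E} − 1 ≥ E`. [folklore] -/
theorem first_factor_ge_exponent {E ηc κP : ℝ} (hηc : 0 ≤ ηc) (hκP : 0 ≤ κP) :
    E ≤ max (1 - Real.exp (-E) * (1 - ηc)) (Real.exp E * (1 + ηc) - 1) + κP := by
  have h1 : E + 1 ≤ Real.exp E := Real.add_one_le_exp E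
  have h0 : 0 ≤ Real.exp E := (Real.exp_pos E).le
  have h2 : E ≤ Real.exp E * (1 + ηc) - 1 := by nlinarith
  exact le_add_of_le_of_nonneg (h2.trans (le_max_right _ _)) hκP

/-- ★ **THE hOD CURRENCY CONSTANT IS RATE-LIMITED**: `b_core ≥ √8·η_c`. [folklore] -/
theorem currency_ge_rate {E ηc κP κQ : ℝ} (hE : 0 ≤ E) (hηc : 0 ≤ ηc) (hηc1 : ηc < 1) (hκP : 0 ≤ κP) (hκP1 : κP < 1) (hκQ : 0 ≤ κQ) (hκQ1 : κQ < 1) :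
    Real.sqrt 8 * ηc ≤ (max (1 - Real.exp (-E) * (1 - ηc)) (Real.exp E * (1 + ηc) - 1) + κP) * Real.sqrt (8 / ((1 - κP) * (1 - ηc) ^ 2 * (1 - κQ))) := by
  rw [mul_comm]
  exact mul_le_mul (first_factor_ge_rate hE hηc hκP) (sqrt_factor_ge hηc hηc1 hκP hκP1 hκQ hκQ1) (Real.sqrt_nonneg _) (hηc.trans (first_factor_ge_rate hE hηc hκP))

/-- `b_core ≥ √8·κ_P`. [folklore] -/
theorem currency_ge_kappaP {E ηc κP κQ : ℝ} (hE : 0 ≤ E) (hηc : 0 ≤ ηc) (hηc1 : ηc < 1) (hκP : 0 ≤ κP) (hκP1 : κP < 1) (hκQ : 0 ≤ κQ) (hκQ1 : κQ < 1) :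
    Real.sqrt 8 * κP ≤ (max (1 - Real.exp (-E) * (1 - ηc)) (Real.exp E * (1 + ηc) - 1) + κP) * Real.sqrt (8 / ((1 - κP) * (1 - ηc) ^ 2 * (1 - κQ))) := by
  rw [mul_comm]
  exact mul_le_mul (first_factor_ge_kappaP hE hηc) (sqrt_factor_ge hηc hηc1 hκP hκP1 hκQ hκQ1) (Real.sqrt_nonneg _) (hκP.trans (first_factor_ge_kappaP hE hηc))

/-- ★ **`b_core ≥ √8·E`**: the currency constant inherits every floor of the core-defect exponent `E = coreEta + coreEps1 + coreEps2` — the (C4) window ledger of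
R54 (`not_hb_small_of_output_radius` / `_of_input_radius`, R53S action slot) applies to `b_core` verbatim with `c = √8`. [folklore] -/
theorem currency_ge_exponent {E ηc κP κQ : ℝ} (hE : 0 ≤ E) (hηc : 0 ≤ ηc) (hηc1 : ηc < 1) (hκP : 0 ≤ κP) (hκP1 : κP < 1) (hκQ : 0 ≤ κQ) (hκQ1 : κQ < 1) :
    Real.sqrt 8 * E ≤ (max (1 - Real.exp (-E) * (1 - ηc)) (Real.exp E * (1 + ηc) - 1) + κP) * Real.sqrt (8 / ((1 - κP) * (1 - ηc) ^ 2 * (1 - κQ))) := by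
  rw [mul_comm]
  exact mul_le_mul (first_factor_ge_exponent hηc hκP) (sqrt_factor_ge hηc hηc1 hκP hκP1 hκQ hκQ1) (Real.sqrt_nonneg _) (hE.trans (first_factor_ge_exponent hηc hκP))

/-- ★★ **A CENTRAL RATE `powScale r β` WITH `r ≤ 1/6` SINKS `hb_small` FOR THE CURRENCY CONSTANT** (`0 < r`; any nonnegative exponent `E`, any `κ_P, κ_Q ∈ [0,1)`):
every `b ≥ b_core` has the floor `√8·powScale r β` (R54 `not_hb_small_of_powScale_floor`).  Lane A's `r = 1/5` is on the good side (next theorem). [folklore] -/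
theorem currency_not_hb_small_of_rate_le_sixth {E κP κQ b : ℝ → ℝ} {r : ℝ} (hr0 : 0 < r) (hr : r ≤ 1 / 6) (hE : ∀ᶠ β : ℝ in atTop, 0 ≤ E β)
    (hκP : ∀ᶠ β : ℝ in atTop, 0 ≤ κP β ∧ κP β < 1) (hκQ : ∀ᶠ β : ℝ in atTop, 0 ≤ κQ β ∧ κQ β < 1)
    (hb : ∀ᶠ β : ℝ in atTop, (max (1 - Real.exp (-E β) * (1 - powScale r β)) (Real.exp (E β) * (1 + powScale r β) - 1) + κP β) *
        Real.sqrt (8 / ((1 - κP β) * (1 - powScale r β) ^ 2 * (1 - κQ β))) ≤ b β) :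
    ¬ ∀ a : ℝ, 0 < a → ∀ᶠ β : ℝ in atTop, b β ^ 2 ≤ a * bareLambda ((L : ℝ) ^ 3 * β) := by
  have h1 : ∀ᶠ β : ℝ in atTop, powScale r β < 1 := (tendsto_powScale' hr0).eventually (eventually_lt_nhds one_pos)
  refine R54.not_hb_small_of_powScale_floor (L := L) (c := Real.sqrt 8) (p := r) (Real.sqrt_pos.mpr (by norm_num)) hr ?_
  filter_upwards [hE, hκP, hκQ, hb, h1] with β hE' hP hQ hb' h1'
  exact (currency_ge_rate hE' (powScale_pos r β).le h1' hP.1 hP.2 hQ.1 hQ.2).trans hb'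

/-- … whereas lane A's rate `r = 1/5` clears this particular floor: `∀ a > 0, ∀ᶠ β, (√8·powScale (1/5) β)² ≤ a·λ_b(L³β)` (`λ_b(L³β) = (2/L³)^{1/3}β^{-1/3}`,
`2/5 − 1/3 = 1/15 > 0`). [folklore] -/
theorem currency_rate_fifth_affordable :
    ∀ a : ℝ, 0 < a → ∀ᶠ β : ℝ in atTop, (Real.sqrt 8 * powScale (1 / 5) β) ^ 2 ≤ a * bareLambda ((L : ℝ) ^ 3 * β) := by
  intro a ha
  have hL : (0 : ℝ) < (L : ℝ) ^ 3 := pow_pos (by exact_mod_cast Nat.pos_of_ne_zero (NeZero.ne L)) 3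
  have hM0 : 0 < (2 / (L : ℝ) ^ 3) ^ ((1 : ℝ) / 3) := Real.rpow_pos_of_pos (by positivity) _
  have ht : Tendsto (fun β : ℝ => 8 * powScale (1 / 15) β) atTop (𝓝 0) := by
    have h := (tendsto_powScale' (by norm_num : (0 : ℝ) < 1 / 15)).const_mul 8
    rw [mul_zero] at h; exact h
  filter_upwards [ht.eventually (eventually_le_nhds (mul_pos ha hM0)), eventually_ge_atTop (1 : ℝ)] with β h hβ1
  have hp : 0 < powScale (1 / 3) β := powScale_pos _ _
  rw [mul_pow, Real.sq_sqrt (by norm_num), R21.powScale_sq, R53.bareLambda_cube_eq_powScale (L := L) hβ1,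
    show (2 * (1 / 5) : ℝ) = 1 / 15 + 1 / 3 by norm_num, ← powScale_mul_powScale]
  calc 8 * (powScale (1 / 15) β * powScale (1 / 3) β) = (8 * powScale (1 / 15) β) * powScale (1 / 3) β := by ring
    _ ≤ (a * (2 / (L : ℝ) ^ 3) ^ ((1 : ℝ) / 3)) * powScale (1 / 3) β := mul_le_mul_of_nonneg_right h hp.le
    _ = a * ((2 / (L : ℝ) ^ 3) ^ ((1 : ℝ) / 3) * powScale (1 / 3) β) := by ring

/-- ★★ **THE (C4) LEDGER TRANSFERS TO `b_core`: THE INPUT-RADIUS SLOT.**  With lane A's windows `δ = D·powScale s β` (`D ≥ 0`), `δu = 14·powScale s β`, `σ = powScale (2s) β`,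
any `R`, `Γ ≥ 0`, any rate `η_c ∈ [0,1)` and `κ_P, κ_Q ∈ [0,1)`: if `s ≤ 1/6` then no `b ≥ b_core` is `hb_small` (`b_core ≥ √8·E`, R54 `not_hb_small_of_input_radius` with
`A = 14`, `p = s`).  So `core_defect_currency` (stated for `0 < s ≤ 1/3`) feeds `hOD` only for `s > 1/6` — with §1, `1/6 < s < 1/5`. [folklore] -/
theorem currency_not_hb_small_of_input_radius {R Γ ηc κP κQ b : ℝ → ℝ} {D s : ℝ} (hD : 0 ≤ D) (hs : s ≤ 1 / 6) (hΓ : ∀ β, 0 ≤ Γ β)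
    (hηc : ∀ᶠ β : ℝ in atTop, 0 ≤ ηc β ∧ ηc β < 1) (hκP : ∀ᶠ β : ℝ in atTop, 0 ≤ κP β ∧ κP β < 1) (hκQ : ∀ᶠ β : ℝ in atTop, 0 ≤ κQ β ∧ κQ β < 1)
    (hb : ∀ᶠ β : ℝ in atTop,
      (max (1 - Real.exp (-(coreEta L β (D * powScale s β) ((D * powScale s β) + (14 * powScale s β)) (9 * (L : ℝ) * (5 * (powScale (1 / 2) β * btLog β ^ 2)) + powScale 1 β)
              (R β) (Γ β) (powScale (2 * s) β) +
            coreEps1 L β (D * powScale s β) (9 * (L : ℝ) * (5 * (powScale (1 / 2) β * btLog β ^ 2)) + powScale 1 β) (R β) +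
            coreEps2 L β (D * powScale s β) (9 * (L : ℝ) * (5 * (powScale (1 / 2) β * btLog β ^ 2)) + powScale 1 β) (R β) (powScale (2 * s) β))) * (1 - ηc β))
          (Real.exp (coreEta L β (D * powScale s β) ((D * powScale s β) + (14 * powScale s β)) (9 * (L : ℝ) * (5 * (powScale (1 / 2) β * btLog β ^ 2)) + powScale 1 β)
              (R β) (Γ β) (powScale (2 * s) β) +
            coreEps1 L β (D * powScale s β) (9 * (L : ℝ) * (5 * (powScale (1 / 2) β * btLog β ^ 2)) + powScale 1 β) (R β) +
            coreEps2 L β (D * powScale s β) (9 * (L : ℝ) * (5 * (powScale (1 / 2) β * btLog β ^ 2)) + powScale 1 β) (R β) (powScale (2 * s) β)) * (1 + ηc β) - 1) + κP β) *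
        Real.sqrt (8 / ((1 - κP β) * (1 - ηc β) ^ 2 * (1 - κQ β))) ≤ b β) :
    ¬ ∀ a : ℝ, 0 < a → ∀ᶠ β : ℝ in atTop, b β ^ 2 ≤ a * bareLambda ((L : ℝ) ^ 3 * β) := by
  refine R54.not_hb_small_of_input_radius (L := L) (δ := fun β => D * powScale s β) (δu := fun β => 14 * powScale s β) (R := R) (Γ := Γ)
    (σ := fun β => powScale (2 * s) β) (c := Real.sqrt 8) (A := 14) (p := s) (Real.sqrt_pos.mpr (by norm_num)) (by norm_num) hs
    (fun β => mul_nonneg hD (powScale_pos s β).le) hΓ (fun β => (powScale_pos _ β).le) (Eventually.of_forall fun β => le_rfl) ?_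
  filter_upwards [hb, hηc, hκP, hκQ, eventually_ge_atTop (0 : ℝ)] with β hb' hη hP hQ hβ0
  have hδ0 : 0 ≤ D * powScale s β := mul_nonneg hD (powScale_pos s β).le
  have hT0 : 0 ≤ 9 * (L : ℝ) * (5 * (powScale (1 / 2) β * btLog β ^ 2)) + powScale 1 β := by
    have := one_le_btLog β; have := powScale_pos (1 / 2) β; have := powScale_pos 1 β; positivity
  have hE0 : 0 ≤ coreEta L β (D * powScale s β) ((D * powScale s β) + (14 * powScale s β)) (9 * (L : ℝ) * (5 * (powScale (1 / 2) β * btLog β ^ 2)) + powScale 1 β)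
        (R β) (Γ β) (powScale (2 * s) β) +
      coreEps1 L β (D * powScale s β) (9 * (L : ℝ) * (5 * (powScale (1 / 2) β * btLog β ^ 2)) + powScale 1 β) (R β) +
      coreEps2 L β (D * powScale s β) (9 * (L : ℝ) * (5 * (powScale (1 / 2) β * btLog β ^ 2)) + powScale 1 β) (R β) (powScale (2 * s) β) :=
    add_nonneg (add_nonneg (coreEta_nonneg hβ0 hδ0 (add_nonneg hδ0 (mul_nonneg (by norm_num) (powScale_pos s β).le)) hT0 (hΓ β) (powScale_pos _ β).le)
      (coreEps1_nonneg hβ0 hδ0 hT0)) (coreEps2_nonneg hβ0 hT0 (powScale_pos _ β).le)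
  exact (currency_ge_exponent hE0 hη.1 hη.2 hP.1 hP.2 hQ.1 hQ.2).trans hb'

end Summit.QuantumFields.YangMills.Theorems.TwistedTraceScaling.Negative.R57

end
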